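import Summits.CriticalPhenomena.CardyFormulaZ2.Theses.CardySelfDualSegment
import Summits.CriticalPhenomena.CardyFormulaZ2.Theorems.UniformBoxCrossing.Negative.LaminatedPaths
import Literature.Probability.Percolation.LongRangeKernelPercolationProofs
import HarnessLib

/-!
# FKG is load-bearing for `UniformBoxCrossing`: the extended corner family and its laminated endpoint
(negative-side support for crux `UniformBoxCrossing`, stmt-CriticalPhenomena-5476, route
`CardySelfDualSegment`; found and kernel-checked by the cdisprove seat (crux workfile
`Cruxes/UniformBoxCrossing/Disproof.lean` §2), landed verbatim by the line lead; part 2 of 5,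
continues `LaminatedPaths`)

The corner family extends verbatim to splitting parameter `s ∈ [0,1]` (`extCornerParam`,
`extCornerPercolation s`; the crux is `s = t/2 ≤ 1/2`, exactly the FKG range of the corner law).
At `s = 1` (laminated endpoint: a.s. every vertex opens exactly one of its east/north edges) the
hard-way crossing probability of `w + [0, 8n] × [0, n]` on `√2 ℤ²` is `≤ 2 (n+1) (32/81)^n`
(`laminated_hardWay_le`, via the orbit reduction of part 1 and the pattern cylinders below), so
`¬ HasBoxCrossingProperty (extCornerPercolation 1)` and the crux with `t ≤ 1` dropped
(`UniformBoxCrossingWithoutFKG`) is FALSE (`uniformBoxCrossing_false_without_FKG`). Consequence: no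
argument using only self-duality, the diagonal symmetry, exact-1/2 identities, translation
invariance and the range-1 product structure can prove the crux — each persists at `s = 1`
(parts 3–4); positive association (`t ≤ 1`) must be used quantitatively.
-/

namespace Summit.CriticalPhenomena.CardyFormulaZ2.Theorems.UniformBoxCrossing.Negative

open MeasureTheory Filter Literature.Probability.Percolation Literature.Probability.LatticeModels
open Summit.CriticalPhenomena.CardyFormulaZ2.Theses.CardySelfDualSegment
open scoped Topology

noncomputable section

/-! ### Orbit patterns and their cylinders -/

/-- Positions of an abstract east/north step pattern `β` (`true` = north) started at `x`. -/
def patPos (β : ℕ → Bool) (x : Site 2) : ℕ → Site 2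
  | 0 => x
  | j + 1 => patPos β x j + (if β j then ![0, 1] else ![1, 0])

/-- A pattern walk starts at `x`. -/
@[simp] theorem patPos_zero (β : ℕ → Bool) (x : Site 2) : patPos β x 0 = x := rfl

/-- One more pattern step. -/
theorem patPos_succ (β : ℕ → Bool) (x : Site 2) (j : ℕ) :
    patPos β x (j + 1) = patPos β x j + (if β j then ![0, 1] else ![1, 0]) := rfl

/-- Abscissa after one more pattern step. -/
theorem patPos_succ_apply_zero (β : ℕ → Bool) (x : Site 2) (j : ℕ) :
    patPos β x (j + 1) 0 = patPos β x j 0 + (if β j then 0 else 1) := by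
  rw [patPos_succ, Pi.add_apply]
  by_cases h : β j
  · rw [if_pos h, if_pos h]; rfl
  · rw [if_neg h, if_neg h]; rfl

/-- Ordinate after one more pattern step. -/
theorem patPos_succ_apply_one (β : ℕ → Bool) (x : Site 2) (j : ℕ) :
    patPos β x (j + 1) 1 = patPos β x j 1 + (if β j then 1 else 0) := by
  rw [patPos_succ, Pi.add_apply]
  by_cases h : β j
  · rw [if_pos h, if_pos h]; rfl
  · rw [if_neg h, if_neg h]; rfl

/-- After `j` pattern steps `x + y` has risen by `j`. -/
theorem patPos_sum (β : ℕ → Bool) (x : Site 2) (j : ℕ) :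
    patPos β x j 0 + patPos β x j 1 = x 0 + x 1 + j := by
  induction j with
  | zero => simp
  | succ j ih =>
    rw [patPos_succ_apply_zero, patPos_succ_apply_one]
    by_cases h : β j
    · rw [if_pos h, if_pos h]; push_cast; linarith
    · rw [if_neg h, if_neg h]; push_cast; linarith

/-- The ordinate after `j` pattern steps counts the north steps so far. -/
theorem patPos_apply_one (β : ℕ → Bool) (x : Site 2) (j : ℕ) :
    patPos β x j 1 = x 1 + ((Finset.range j).filter fun i => β i = true).card := by
  induction j with
  | zero => simp
  | succ j ih =>
    rw [patPos_succ_apply_one, Finset.range_add_one, Finset.filter_insert, ih]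
    by_cases h : β j
    · rw [if_pos h, if_pos h, Finset.card_insert_of_notMem (by simp)]; push_cast; ring
    · rw [if_neg h, if_neg h]; ring

/-- A pattern walk never revisits a vertex. -/
theorem patPos_injective (β : ℕ → Bool) (x : Site 2) : Function.Injective (patPos β x) := by
  intro i j h
  have hi := patPos_sum β x i
  have hj := patPos_sum β x j
  rw [h] at hi
  omega

/-- The step pattern of a finite set `s ⊆ {0, …, K-1}` of north positions. -/
def extB {K : ℕ} (s : Finset (Fin K)) (i : ℕ) : Bool := if h : i < K then decide (⟨i, h⟩ ∈ s) else false

/-- `extB s` is the indicator of `s` below `K`. -/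
theorem extB_eq_true_iff {K : ℕ} (s : Finset (Fin K)) {i : ℕ} (hi : i < K) :
    extB s i = true ↔ (⟨i, hi⟩ : Fin K) ∈ s := by
  simp [extB, hi]

/-- The number of north steps of the pattern of `s` is `|s|`. -/
theorem card_filter_extB {K : ℕ} (s : Finset (Fin K)) :
    ((Finset.range K).filter fun i => extB s i = true).card = s.card := by
  have h : ((Finset.range K).filter fun i => extB s i = true) = s.map Fin.valEmbedding := by
    ext i
    simp only [Finset.mem_filter, Finset.mem_range, Finset.mem_map, Fin.valEmbedding_apply]
    constructor
    · rintro ⟨hi, he⟩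
      exact ⟨⟨i, hi⟩, (extB_eq_true_iff s hi).1 he, rfl⟩
    · rintro ⟨j, hj, rfl⟩
      exact ⟨j.2, (extB_eq_true_iff s j.2).2 hj⟩
  rw [h, Finset.card_map]

/-- The coin cylinder of the pattern `s` started at `x`: the coin at the `j`-th position is heads
(east) iff `j ∉ s`. -/
def patCyl {K : ℕ} (x : Site 2) (s : Finset (Fin K)) : Set (Set (Site 2 × Fin 2)) :=
  {S | ∀ j : Fin K, ((patPos (extB s) x j, (0 : Fin 2)) ∈ S ↔ j ∉ s)}

/-- The set of coins (heads) of `S`. -/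
def coins (S : Set (Site 2 × Fin 2)) : Set (Site 2) := {v | (v, (0 : Fin 2)) ∈ S}

/-- Membership in `coins S`, unfolded. -/
@[simp] theorem mem_coins {S : Set (Site 2 × Fin 2)} {v : Site 2} : v ∈ coins S ↔ (v, (0 : Fin 2)) ∈ S :=
  Iff.rfl

open Classical in
/-- The north pattern of the first `K` orbit steps of the coins of `S`. -/
def patOf (S : Set (Site 2 × Fin 2)) (x : Site 2) (K : ℕ) : Finset (Fin K) :=
  Finset.univ.filter fun j => lamOrbit (coins S) x j ∉ coins S

/-- Membership in the north pattern, unfolded. -/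
theorem mem_patOf_iff (S : Set (Site 2 × Fin 2)) (x : Site 2) (K : ℕ) (j : Fin K) :
    j ∈ patOf S x K ↔ lamOrbit (coins S) x j ∉ coins S := by
  simp [patOf]

/-- The pattern of `S` records the north steps of the orbit. -/
theorem extB_patOf_eq_true_iff (S : Set (Site 2 × Fin 2)) (x : Site 2) (K : ℕ) {i : ℕ} (hi : i < K) :
    extB (patOf S x K) i = true ↔ lamOrbit (coins S) x i ∉ coins S := by
  rw [extB_eq_true_iff _ hi, mem_patOf_iff]

/-- The orbit of the coins of `S` is the pattern walk of its own north pattern. -/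
theorem lamOrbit_eq_patPos (S : Set (Site 2 × Fin 2)) (x : Site 2) (K : ℕ) :
    ∀ j, j ≤ K → lamOrbit (coins S) x j = patPos (extB (patOf S x K)) x j := by
  intro j
  induction j with
  | zero => intro; rfl
  | succ j ih =>
    intro hj
    have hjK : j < K := by omega
    rw [lamOrbit_succ, patPos_succ, ← ih hjK.le]
    unfold lamStep
    by_cases h : lamOrbit (coins S) x j ∈ coins S
    · have hb : ¬ (extB (patOf S x K) j = true) := fun hb =>
        ((extB_patOf_eq_true_iff S x K hjK).1 hb) h
      rw [if_pos h, if_neg hb]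
    · have hb : extB (patOf S x K) j = true := (extB_patOf_eq_true_iff S x K hjK).2 h
      rw [if_neg h, if_pos hb]

/-- `S` lies in the cylinder of its own pattern. -/
theorem mem_patCyl_patOf (S : Set (Site 2 × Fin 2)) (x : Site 2) (K : ℕ) : S ∈ patCyl x (patOf S x K) := by
  intro j
  rw [← lamOrbit_eq_patPos S x K j (le_of_lt j.2), mem_patOf_iff, not_not]
  rfl

/-- The ordinate after `K` orbit steps counts the north steps. -/
theorem lamOrbit_apply_one_eq (S : Set (Site 2 × Fin 2)) (x : Site 2) (K : ℕ) :
    lamOrbit (coins S) x K 1 = x 1 + (patOf S x K).card := by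
  rw [lamOrbit_eq_patPos S x K K le_rfl, patPos_apply_one, card_filter_extB]

/-- The orbit event is covered by the cylinders of the patterns with few north steps. -/
theorem orbitEvent_subset (x : Site 2) (K : ℕ) (n : ℕ) :
    {S : Set (Site 2 × Fin 2) | lamOrbit (coins S) x K 1 ≤ x 1 + n} ⊆
      ⋃ s ∈ (Finset.univ : Finset (Finset (Fin K))).filter (fun s => s.card ≤ n), patCyl x s := by
  intro S hS
  simp only [Set.mem_setOf_eq, lamOrbit_apply_one_eq] at hS
  simp only [Set.mem_iUnion, Finset.mem_filter, Finset.mem_univ, true_and, exists_prop]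
  exact ⟨patOf S x K, by exact_mod_cast (by linarith : ((patOf S x K).card : ℤ) ≤ n),
    mem_patCyl_patOf S x K⟩


/-- Every orbit cylinder of length `K` has probability `(1/2)^K` when the coins are fair. -/
theorem real_patCyl (p : Site 2 × Fin 2 → unitInterval) (hp : ∀ v, p (v, 0) = half)
    {K : ℕ} (x : Site 2) (s : Finset (Fin K)) :
    (prodBernoulli p).real (patCyl x s) = (1 / 2 : ℝ) ^ K := by
  have hφ : Function.Injective fun j : Fin K => (patPos (extB s) x j, (0 : Fin 2)) := by
    intro i j h
    simp only [Prod.mk.injEq, and_true] at h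
    exact Fin.ext (patPos_injective _ _ h)
  have h := prodBernoulli_real_cylinder_of_injective p hφ (fun j => j ∉ s)
  rw [patCyl, h]
  simp only [hp, ber_half_real_iff, Finset.prod_const, Finset.card_univ, Fintype.card_fin]

/-- Counting patterns with few north steps by weighting: `#{s ⊆ Fin K : |s| ≤ n} ≤ 3^n (4/3)^K`. -/
theorem card_filter_card_le (K n : ℕ) :
    (((Finset.univ : Finset (Finset (Fin K))).filter (fun s => s.card ≤ n)).card : ℝ) ≤
      3 ^ n * (4 / 3 : ℝ) ^ K := by
  set A := (Finset.univ : Finset (Finset (Fin K))).filter (fun s => s.card ≤ n) with hA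
  have h1 : (A.card : ℝ) = ∑ s ∈ A, (1 : ℝ) := by simp
  have h2 : ∑ s ∈ A, (1 : ℝ) ≤ ∑ s ∈ A, 3 ^ n * (1 / 3 : ℝ) ^ s.card := by
    refine Finset.sum_le_sum fun s hs => ?_
    have hsn : s.card ≤ n := (Finset.mem_filter.1 hs).2
    calc (1 : ℝ) = 3 ^ s.card * (1 / 3 : ℝ) ^ s.card := by rw [← mul_pow]; norm_num
      _ ≤ 3 ^ n * (1 / 3 : ℝ) ^ s.card := by gcongr; norm_num
  have h3 : ∑ s ∈ A, 3 ^ n * (1 / 3 : ℝ) ^ s.card ≤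
      ∑ s : Finset (Fin K), 3 ^ n * (1 / 3 : ℝ) ^ s.card :=
    Finset.sum_le_sum_of_subset_of_nonneg (Finset.filter_subset _ _) fun _ _ _ => by positivity
  have h4 : ∑ s : Finset (Fin K), 3 ^ n * (1 / 3 : ℝ) ^ s.card = 3 ^ n * (4 / 3 : ℝ) ^ K := by
    rw [← Finset.mul_sum]
    congr 1
    have := Fin.sum_pow_mul_eq_add_pow (n := K) (1 / 3 : ℝ) 1
    simp only [one_pow, mul_one] at this
    rw [this]; norm_num
  linarith

/-- **The orbit bound**: with fair coins, the forward lamination orbit of `x` makes at most `n`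
north steps among its first `5n` steps with probability at most
`3^n (4/3)^(5n) (1/2)^(5n) = (32/81)^n`. -/
theorem real_orbitEvent_le (p : Site 2 × Fin 2 → unitInterval) (hp : ∀ v, p (v, 0) = half)
    (x : Site 2) (n : ℕ) :
    (prodBernoulli p).real {S | lamOrbit (coins S) x (5 * n) 1 ≤ x 1 + n} ≤ (32 / 81 : ℝ) ^ n := by
  classical
  set A := (Finset.univ : Finset (Finset (Fin (5 * n)))).filter (fun s => s.card ≤ n) with hA
  calc (prodBernoulli p).real {S | lamOrbit (coins S) x (5 * n) 1 ≤ x 1 + n}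
      ≤ (prodBernoulli p).real (⋃ s ∈ A, patCyl x s) :=
        measureReal_mono (orbitEvent_subset x (5 * n) n) (measure_ne_top _ _)
    _ ≤ ∑ s ∈ A, (prodBernoulli p).real (patCyl x s) := measureReal_biUnion_finset_le _ _
    _ = A.card * (1 / 2 : ℝ) ^ (5 * n) := by simp [real_patCyl p hp, Finset.sum_const]
    _ ≤ (3 ^ n * (4 / 3 : ℝ) ^ (5 * n)) * (1 / 2 : ℝ) ^ (5 * n) := by
        gcongr; exact card_filter_card_le (5 * n) n
    _ = (32 / 81 : ℝ) ^ n := by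
        rw [pow_mul, pow_mul, ← mul_pow, ← mul_pow]; norm_num

/-! ### The extended corner family `s ∈ [0,1]` and its laminated endpoint `s = 1` -/

/-- Extended corner parameters: the coin `(v, 0)` is fair, the splitting bit `(v, 1)` has
parameter `s ∈ [0, 1]` (disagreement probability `s`). The route's family is `s = t/2 ≤ 1/2`,
which is exactly the range where the corner law `(1/2 - s/2 | s/2, s/2 | 1/2 - s/2)` satisfies the
FKG lattice condition; `s ∈ (1/2, 1]` is the non-FKG continuation of the same self-dual family. -/
def extCornerParam (s : unitInterval) : Site 2 × Fin 2 → unitInterval :=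
  fun i => if i.2 = 0 then half else s

/-- The coin coordinate is fair. -/
@[simp] theorem extCornerParam_apply_zero (s : unitInterval) (v : Site 2) :
    extCornerParam s (v, 0) = half := by
  simp [extCornerParam]

/-- The splitting coordinate has parameter `s`. -/
@[simp] theorem extCornerParam_apply_one (s : unitInterval) (v : Site 2) :
    extCornerParam s (v, 1) = s := by
  simp [extCornerParam]

/-- The route's parameters are the extended ones at `s = t/2`. -/
theorem extCornerParam_half_mul (t : unitInterval) : extCornerParam (half * t) = cornerParam t := by
  funext ⟨v, j⟩
  fin_cases j
  · simp [extCornerParam]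
  · simp [extCornerParam]

/-- The extended corner model `M_s`: push-forward of `prodBernoulli (extCornerParam s)` under the
corner map. -/
def extCornerPercolation (s : unitInterval) : Measure (BondConfig (Site 2)) :=
  (prodBernoulli (extCornerParam s)).map cornerConfig

/-- The route's `cornerPercolation t` is `extCornerPercolation (t/2)`. -/
theorem extCornerPercolation_half_mul (t : unitInterval) :
    extCornerPercolation (half * t) = cornerPercolation t := by
  rw [extCornerPercolation, extCornerParam_half_mul, cornerPercolation_def]

/-- `M_s` is a probability measure. -/
instance instIsProbabilityMeasureExtCornerPercolation (s : unitInterval) :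
    IsProbabilityMeasure (extCornerPercolation s) :=
  Measure.isProbabilityMeasure_map measurable_cornerConfig.aemeasurable

/-- At the laminated endpoint `s = 1` every splitting bit is almost surely present. -/
theorem ae_forall_splitting_mem :
    ∀ᵐ S ∂(prodBernoulli (extCornerParam 1)), ∀ v : Site 2, (v, (1 : Fin 2)) ∈ S := by
  rw [ae_all_iff]
  intro v
  have h : (prodBernoulli (extCornerParam 1)).real {S | (v, (1 : Fin 2)) ∉ S} = 0 := by
    rw [prodBernoulli_real_setOf_notMem, extCornerParam_apply_one]
    simp
  rw [ae_iff]
  exact (measureReal_eq_zero_iff (measure_ne_top _ _)).1 h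

/-- **Lamination bound.** At `s = 1` (every vertex opens exactly one of its east/north edges, a.s.)
the horizontal crossing probability of `w + [0, 8n] × [0, n]` on `√2 ℤ²` is at most
`2 (n + 1) (32/81)^n`, uniformly in the translation `w`. -/
theorem laminated_hardWay_le (w : ℂ) (n : ℕ) :
    (extCornerPercolation 1).real
        (embRectCrossing (fun v => squareLatticeEmbedding.z v - w) (8 * n) n) ≤
      2 * (n + 1) * (32 / 81 : ℝ) ^ n := by
  set E := embRectCrossing (fun v => squareLatticeEmbedding.z v - w) (8 * n) n with hE
  have hEm : MeasurableSet E := measurableSet_openCrossing_of_countable _ _ _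
  rw [extCornerPercolation, map_measureReal_apply measurable_cornerConfig hEm]
  set μ := prodBernoulli (extCornerParam 1) with hμ
  set G : Set (Set (Site 2 × Fin 2)) := {S | ∀ v, (v, (1 : Fin 2)) ∈ S} with hG
  have hsub : cornerConfig ⁻¹' E ⊆
      (⋃ x ∈ startBox w n, {S | lamOrbit (coins S) x (5 * n) 1 ≤ x 1 + n}) ∪ Gᶜ := by
    intro S hS
    by_cases hSG : S ∈ G
    · left
      have hlam : lamConfig (coins S) ∈ E := by
        have := cornerConfig_eq_lamConfig hSG
        rw [Set.mem_preimage, this] at hS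
        exact hS
      obtain ⟨x, hx, hbad⟩ := lam_crossing_orbit (coins S) w n hlam
      simp only [Set.mem_iUnion, exists_prop]
      exact ⟨x, hx, hbad⟩
    · exact Or.inr hSG
  have hG0 : μ.real Gᶜ = 0 := by
    have h := ae_forall_splitting_mem
    rw [ae_iff] at h
    rw [measureReal_eq_zero_iff (measure_ne_top _ _)]
    exact h
  calc μ.real (cornerConfig ⁻¹' E)
      ≤ μ.real ((⋃ x ∈ startBox w n, {S | lamOrbit (coins S) x (5 * n) 1 ≤ x 1 + n}) ∪ Gᶜ) :=
        measureReal_mono hsub (measure_ne_top _ _)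
    _ ≤ μ.real (⋃ x ∈ startBox w n, {S | lamOrbit (coins S) x (5 * n) 1 ≤ x 1 + n}) +
          μ.real Gᶜ := measureReal_union_le _ _
    _ ≤ ∑ x ∈ startBox w n, μ.real {S | lamOrbit (coins S) x (5 * n) 1 ≤ x 1 + n} + 0 := by
        rw [hG0]
        gcongr
        exact measureReal_biUnion_finset_le _ _
    _ ≤ ∑ x ∈ startBox w n, (32 / 81 : ℝ) ^ n + 0 := by
        gcongr with x hx
        exact real_orbitEvent_le _ (fun v => extCornerParam_apply_zero 1 v) x n
    _ = 2 * (n + 1) * (32 / 81 : ℝ) ^ n := by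
        rw [Finset.sum_const, card_startBox, add_zero, nsmul_eq_mul]
        push_cast
        ring

/-- The lamination bound tends to `0`. -/
theorem tendsto_laminated_bound :
    Tendsto (fun n : ℕ => 2 * (n + 1) * (32 / 81 : ℝ) ^ n) atTop (𝓝 0) := by
  have h1 := tendsto_self_mul_const_pow_of_lt_one (r := (32 / 81 : ℝ)) (by norm_num) (by norm_num)
  have h2 := tendsto_pow_atTop_nhds_zero_of_lt_one (r := (32 / 81 : ℝ)) (by norm_num) (by norm_num)
  have h3 := (h1.add h2).const_mul 2
  simp only [mul_zero, add_zero] at h3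
  refine h3.congr fun n => ?_
  ring

/-- **No box-crossing bounds at the laminated endpoint**, for any constants, at aspect ratio `8`. -/
theorem not_boxCrossingBounds_laminated {c : ℝ} (hc : 0 < c) (n₀ : ℕ) :
    ¬ BoxCrossingBounds (extCornerPercolation 1) squareLatticeEmbedding.z 8 c n₀ := by
  intro h
  obtain ⟨N, hN⟩ := (tendsto_laminated_bound.eventually (gt_mem_nhds hc)).exists_forall_of_atTop
  have h1 := (h (max N n₀) (le_max_right _ _) 0).1.1
  have h2 := laminated_hardWay_le 0 (max N n₀)
  have h3 := hN (max N n₀) (le_max_left _ _)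
  linarith

/-- **`M_1^{ext}` (the laminated corner model) does not have the box-crossing property on `√2 ℤ²`.** -/
theorem not_hasBoxCrossingProperty_laminated :
    ¬ HasBoxCrossingProperty (extCornerPercolation 1) squareLatticeEmbedding.z := by
  intro h
  obtain ⟨c, hc, n₀, hb⟩ := h 8 (by norm_num)
  exact not_boxCrossingBounds_laminated hc n₀ hb

/-- `UniformBoxCrossing` with the FKG restriction `t ≤ 1` (i.e. `s ≤ 1/2`) DROPPED: uniform box
crossing along the whole extended self-dual segment `s ∈ [0, 1]`. A STRENGTHENING of the crux that
this file REFUTES (`uniformBoxCrossing_false_without_FKG`); posited by the disproof side of the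
crux chain, not a literature fact, never to be relocated. -/
def UniformBoxCrossingWithoutFKG : Prop :=
  ∀ ρ : ℝ, 0 < ρ → ∃ c > 0, ∃ n₀ : ℕ, ∀ s : unitInterval,
    BoxCrossingBounds (extCornerPercolation s) squareLatticeEmbedding.z ρ c n₀

/-- **FKG is load-bearing**: the extended statement is false (witness `s = 1`, `ρ = 8`). Any proof
of `UniformBoxCrossing` must use an input that fails beyond `t = 1` — the FKG lattice condition of
the corner law (equivalently positive association of `M_t`), since translation invariance,
diagonal symmetry, self-duality, exact-`1/2` squares and range-`1` dependence all persist up to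
`s = 1`. -/
theorem uniformBoxCrossing_false_without_FKG : ¬ UniformBoxCrossingWithoutFKG := by
  intro h
  obtain ⟨c, hc, n₀, hb⟩ := h 8 (by norm_num)
  exact not_boxCrossingBounds_laminated hc n₀ (hb 1)


end

end Summit.CriticalPhenomena.CardyFormulaZ2.Theorems.UniformBoxCrossing.Negative
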